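import Literature.Analysis.FluidPDE.LeiRenZhang2019SwirlPair
import Literature.Analysis.FluidPDE.KNSSLemma21Proof
import HarnessLib

/-!
# Lei–Ren–Zhang 2019, Theorem 1.2: a swirl vanishing far from the axis vanishes; the sign of the swirl at infinity

Analysis/FluidPDE support file (all results proved; no definitions, no named facts) on the
discharge path of the named fact `Literature.Analysis.FluidPDE.leiRenZhang2019_liouville_swirl_rate`
(`SelfSimilarLiouville`; Z. Lei, X. Ren, Q. S. Zhang, arXiv:1902.11229, Theorem 1.2).

Two auxiliary steps for bounded-drift swirl pairs `(F, V)` (the hypotheses of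
`LeiRenZhang2019SwirlPair`, unbundled):

* `LRZPair.eq_zero_of_vanish_far` — **the case `L = 0` of the rate hypothesis.** If the scalar
  `F` of an ancient pair vanishes on `{r ≥ R₀}` and `|F| ≤ K r` (as the swirl `r u_θ` of a
  bounded field does), then `F ≡ 0`. Proof by Koch–Nadirashvili–Seregin–Šverák's Lemma 2.1
  (arXiv:0709.3599, p. 5; the tree's theorem `KNSS2009_lemma21_holds`), in the way the tree's
  `IsKNSSSwirlPair.exists_rescale_ge` uses it: if `M = sup F > 0`, a point with `F` almost `M`
  lies at distance `∈ (M/2K, R₀)` from the axis; after a translation in `z` and `t`, Lemma 2.1 on an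
  annular cylinder `{ρ/2 < r < R₀ + 3, |z| < 2}` makes `F ≥ M/2 > 0` on
  `{3ρ/4 < r < R₀ + 5/2, |z| < 3/2} × (1/2, 1)`, which contains points with `r > R₀` where `F = 0`.
  (In print this case is covered by Lei–Zhang–Zhao's Remark 1.4, arXiv:1701.00868, whose Lemma 5.2
  is the same maximum-principle argument.)
* `LRZPair.pos_or_neg_of_sq_ge` — **the sign of `F` far from the axis.** If `F² ≥ c > 0` on
  `{r ≥ R₁}` at all times, then `F > 0` there at all times or `F < 0` there at all times: `F` is an
  axisymmetric scalar, `F(t, x) = F(t, (r, 0, z))`, and `(t, r, z)` ranges over a convex set on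
  which `F` is continuous and does not vanish.

## References

* Z. Lei, X. Ren, Q. S. Zhang, arXiv:1902.11229, Theorem 1.2, §4. [LeiRenZhang2019]
* G. Koch, N. Nadirashvili, G. Seregin, V. Šverák, Acta Math. 203 (2009) = arXiv:0709.3599,
  Lemma 2.1 (p. 5) and the proof of Theorem 5.3 (p. 10). [KochNadirashviliSereginSverak2009]
* Z. Lei, Q. S. Zhang, N. Zhao, arXiv:1701.00868, Remark 1.4 and Lemma 5.2. [LeiZhangZhao2017]
-/

noncomputable section

open MeasureTheory Set Function Filter Topology TopologicalSpace InnerProductSpace WithLp Metric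
open scoped Laplacian RealInnerProductSpace ContDiff

namespace Literature.Analysis.FluidPDE

namespace LRZPair

variable {Cf Cu τ : ℝ} {F : ℝ → (EuclideanSpace ℝ (Fin 3)) → ℝ}
  {V : ℝ → (EuclideanSpace ℝ (Fin 3)) → (EuclideanSpace ℝ (Fin 3))}

/-! ### Vanishing far from the axis forces vanishing -/

section Vanishing

/-- **`sup F ≤ 0` for a scalar vanishing far from the axis** (Lemma 2.1 step): for a
bounded-drift swirl pair on `(−∞, τ)` with `|F| ≤ K r` and `F = 0` on `{r ≥ R₀}`, `F ≤ 0`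
everywhere. [cite: KochNadirashviliSereginSverak2009, Lemma 2.1 (arXiv p. 5) and proof of Thm 5.3, (5.14) (p. 10)] -/
theorem nonpos_of_vanish_far
    (hF : ∀ t < τ, ContDiff ℝ ∞ (F t))
    (hFd : ContinuousOn (fun p : ℝ × (EuclideanSpace ℝ (Fin 3)) => fderiv ℝ (F p.1) p.2) (Iio τ ×ˢ univ))
    (hFΔ : ContinuousOn (fun p : ℝ × (EuclideanSpace ℝ (Fin 3)) => (Δ (F p.1)) p.2) (Iio τ ×ˢ univ))
    (hFa : ∀ t < τ, IsAxisymmetricScalar (F t))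
    (hF0 : ∀ t < τ, ∀ x, cylRadius x = 0 → F t x = 0)
    (hFb : ∀ t < τ, ∀ x, |F t x| ≤ Cf)
    (hVm : Measurable (uncurry V))
    (hVs : ∀ t < τ, ContDiff ℝ ∞ (V t))
    (hVdiv : ∀ t < τ, VectorCalculus.IsDivFree (V t))
    (hVb : ∀ t < τ, ∀ x, ‖V t x‖ ≤ Cu)
    (heq : ∀ x, cylRadius x ≠ 0 → ∀ s t : ℝ, s ≤ t → t < τ →
      F t x - F s x = ∫ r in s..t, ((Δ (F r)) x - fderiv ℝ (F r) x (V r x) -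
        2 / cylRadius x * partialDeriv (eR x) (F r) x))
    {K R₀ : ℝ} (hK : ∀ t < τ, ∀ x, |F t x| ≤ K * cylRadius x)
    (hfar : ∀ t < τ, ∀ x, R₀ ≤ cylRadius x → F t x = 0) :
    ∀ t < τ, ∀ x, F t x ≤ 0 := by
  intro t₀ ht₀ x₀
  by_contra hxt
  have hpos : 0 < F t₀ x₀ := lt_of_not_ge hxt
  have hCf : 0 ≤ Cf := (abs_nonneg _).trans (hFb (τ - 1) (by linarith) 0)
  have hCu : 0 ≤ Cu := (norm_nonneg _).trans (hVb (τ - 1) (by linarith) 0)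
  have hVr : ∀ t < τ, ∀ x, |⟪V t x, eR x⟫| ≤ Cu := fun t ht x => (abs_inner_eR_le _ _).trans (hVb t ht x)
  -- `K > 0`
  have hKpos : 0 < K := by
    have h1 := hK t₀ ht₀ x₀
    have h2 : F t₀ x₀ ≤ K * cylRadius x₀ := (le_abs_self _).trans h1
    have hr0 : cylRadius x₀ ≠ 0 := fun h => by rw [hF0 t₀ ht₀ x₀ h] at hpos; exact lt_irrefl _ hpos
    have hr : 0 < cylRadius x₀ := lt_of_le_of_ne (cylRadius_nonneg _) (Ne.symm hr0)
    by_contra hK0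
    have : K * cylRadius x₀ ≤ 0 := mul_nonpos_of_nonpos_of_nonneg (le_of_not_gt hK0) hr.le
    linarith
  -- the supremum `M` of `F`
  set S : Set ℝ := {v | ∃ t < τ, ∃ x, F t x = v} with hS
  have hbdd : BddAbove S := ⟨Cf, by rintro v ⟨t, ht, x, rfl⟩; exact (le_abs_self _).trans (hFb t ht x)⟩
  have hne : S.Nonempty := ⟨F t₀ x₀, t₀, ht₀, x₀, rfl⟩
  set M : ℝ := sSup S with hMdef
  have hM : 0 < M := lt_of_lt_of_le hpos (le_csSup hbdd ⟨t₀, ht₀, x₀, rfl⟩)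
  have hMCf : M ≤ Cf := csSup_le hne (by rintro v ⟨t, ht, x, rfl⟩; exact (le_abs_self _).trans (hFb t ht x))
  have hfM : ∀ t < τ, ∀ x, F t x ≤ M := fun t ht x => le_csSup hbdd ⟨t, ht, x, rfl⟩
  have happr : ∀ η > 0, ∃ t < τ, ∃ x, M - η < F t x := by
    intro η hη
    obtain ⟨v, ⟨t, ht, x, rfl⟩, hv⟩ := exists_lt_of_lt_csSup hne (by linarith : M - η < M)
    exact ⟨t, ht, x, hv⟩
  -- near-maximum points are at distance `∈ (ρ, R₀)` from the axis, `ρ = M/(2K)`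
  set ρ : ℝ := M / (2 * K) with hρ
  have hρpos : 0 < ρ := by positivity
  have hloc : ∀ t < τ, ∀ x, M / 2 < F t x → ρ < cylRadius x ∧ cylRadius x < R₀ := by
    intro t ht x hx
    constructor
    · have h1 : F t x ≤ K * cylRadius x := (le_abs_self _).trans (hK t ht x)
      rw [hρ, div_lt_iff₀ (by positivity)]
      nlinarith
    · by_contra h
      have := hfar t ht x (le_of_not_gt h)
      linarith
  have hρR : ρ < R₀ := by
    obtain ⟨t, ht, x, hx⟩ := happr (M / 2) (by positivity)
    obtain ⟨h1, h2⟩ := hloc t ht x (by linarith)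
    exact h1.trans h2
  -- the configuration of Lemma 2.1
  set Ω : Set (EuclideanSpace ℝ (Fin 3)) := annCyl (ρ / 2) (R₀ + 3) 2 with hΩ
  set Ω' : Set (EuclideanSpace ℝ (Fin 3)) := annCyl (3 * ρ / 4) (R₀ + 5 / 2) (3 / 2) with hΩ'
  set Kc : Set (EuclideanSpace ℝ (Fin 3)) := annCylClosed ρ (R₀ + 2) 1 with hKc
  have hΩo : IsOpen Ω := isOpen_annCyl _ _ _
  have hΩb : Bornology.IsBounded Ω := isBounded_annCyl _ _ _
  have hΩc : IsConnected Ω := isConnected_annCyl (by positivity) (by linarith) (by norm_num)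
  have hcl : closure Ω' ⊆ Ω :=
    (closure_annCyl_subset _ _ _).trans (annCylClosed_subset_annCyl (by linarith) (by linarith) (by norm_num))
  have hKcpt : IsCompact Kc := isCompact_annCylClosed _ _ _
  have hKΩ : Kc ⊆ Ω := annCylClosed_subset_annCyl (by linarith) (by linarith) (by norm_num)
  have hKΩ' : Kc ⊆ Ω' := annCylClosed_subset_annCyl (by linarith) (by linarith) (by norm_num)
  have hΩr : ∀ y ∈ Ω, ρ / 2 < cylRadius y := fun y hy => hy.1
  set M' : ℝ := M + Cf with hM'
  have hM'pos : 0 < M' := by positivity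
  set ε : ℝ := M / (2 * M') with hε
  have hεpos : 0 < ε := by positivity
  obtain ⟨δ, hδ, hP⟩ := KNSS2009_lemma21_holds (EuclideanSpace ℝ (Fin 3)) (T := 1) (A := 1 * Cu + 2 / (ρ / 2))
    hΩo hΩb hΩc hcl hKcpt hKΩ (one_half_pos : (0 : ℝ) < 1 / 2) hεpos
  -- a near-maximum point
  set η : ℝ := min (M' * δ) (M / 2) with hη
  have hηpos : 0 < η := lt_min (by positivity) (by positivity)
  obtain ⟨tstar, htstar, xstar, hnear⟩ := happr η hηpos
  have hxr : ρ < cylRadius xstar ∧ cylRadius xstar < R₀ :=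
    hloc tstar htstar xstar (by linarith [min_le_right (M' * δ) (M / 2)])
  -- the translated pair `F'(s, y) = F(t* + (s − 1), x*₂ e_z + y)`
  obtain ⟨hF', hFd', hFΔ', -, -, hFb', hVm', -, -, hVb', -, heq'⟩ :=
    rescale hF hFd hFΔ hFa hF0 hFb hVm hVs hVdiv hVb hVr heq one_pos tstar (xstar 2) 1
  have hτ₁ : (1 : ℝ) < 1 + (τ - tstar) / (1 : ℝ) ^ 2 := by
    have : 0 < (τ - tstar) / (1 : ℝ) ^ 2 := by rw [one_pow, div_one]; linarith
    linarith
  set F' := stPull ((1 : ℝ) ^ 2) 1 (tstar - (1 : ℝ) ^ 2 * 1) ((xstar 2) • eZ) F with hF'def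
  set V' := (1 : ℝ) • stPull ((1 : ℝ) ^ 2) 1 (tstar - (1 : ℝ) ^ 2 * 1) ((xstar 2) • eZ) V with hV'def
  have hFval : ∀ s y, F' s y = F (tstar + (s - 1)) ((xstar 2) • eZ + y) := by
    intro s y
    rw [hF'def, stPull_rescale_apply]
    simp
  have htime : ∀ s, s ≤ 1 → tstar + (s - 1) < τ := fun s hs => by linarith
  obtain ⟨hb_meas, hb_bd, hg_C2, hg_cont1, hg_cont2, hg_eq⟩ :=
    lemma21_data hF' hFd' hFΔ' hVm' hVb' heq' hτ₁ Cf (half_pos hρpos) hΩr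
  -- `|g| ≤ M'` on `(0, 1] × Ω` for `g = F' + Cf`
  have hg_bd : ∀ s ∈ Ioc (0 : ℝ) 1, ∀ y ∈ Ω, |F' s y + Cf| ≤ M' := by
    intro s hs y _
    rw [hFval]
    have h1 := hfM _ (htime s hs.2) ((xstar 2) • eZ + y)
    have h2 := (_root_.abs_le.1 (hFb _ (htime s hs.2) ((xstar 2) • eZ + y))).1
    rw [_root_.abs_le]
    constructor <;> linarith
  -- the near-maximum point sits at `(1, y₀)` with `y₀ ∈ Kc`
  set y₀ : EuclideanSpace ℝ (Fin 3) := xstar - (xstar 2) • eZ with hy₀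
  have hy₀eq : (xstar 2) • eZ + y₀ = xstar := by rw [hy₀]; abel
  have hy₀r : cylRadius y₀ = cylRadius xstar := by
    have h := SereginSverak2009.cylRadius_smul_eZ_add (xstar 2) y₀
    rw [hy₀eq] at h
    exact h.symm
  have hy₀z : y₀ 2 = 0 := by simp [hy₀, eZ]
  have hy₀K : y₀ ∈ Kc := by
    refine ⟨by rw [hy₀r]; exact hxr.1.le, by rw [hy₀r]; linarith [hxr.2], ?_⟩
    rw [hy₀z, abs_zero]; exact zero_le_one
  have hnear' : ∃ x ∈ Kc, M' * (1 - δ) ≤ F' 1 x + Cf := by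
    refine ⟨y₀, hy₀K, ?_⟩
    rw [hFval, sub_self, add_zero, hy₀eq]
    have hηδ : η ≤ M' * δ := min_le_left _ _
    nlinarith
  -- Lemma 2.1: `g ≥ M'(1 − ε)` on `Ω' × (1/2, 1)`
  have key := hP hb_meas hb_bd hg_C2 hg_cont1 hg_cont2 hg_eq hM'pos hg_bd hnear'
  -- evaluate at `s = 3/4` and the point `(R₀ + 1, 0, 0) ∈ Ω'`, where `F' = 0`
  set y₁ : EuclideanSpace ℝ (Fin 3) := meridianPoint (R₀ + 1, 0) with hy₁
  have hR₀ : 0 < R₀ := hρpos.trans hρR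
  have hy₁r : cylRadius y₁ = R₀ + 1 := by
    rw [hy₁, cylRadius_meridianPoint_eq_abs, abs_of_pos (by linarith)]
  have hy₁z : y₁ 2 = 0 := by simp [hy₁]
  have hy₁Ω' : y₁ ∈ Ω' := by
    refine ⟨by rw [hy₁r]; linarith, by rw [hy₁r]; linarith, ?_⟩
    rw [hy₁z, abs_zero]; norm_num
  have hval := key (3 / 4) ⟨by norm_num, by norm_num⟩ y₁ hy₁Ω'
  have hzero : F' (3 / 4) y₁ = 0 := by
    rw [hFval]
    refine hfar _ (htime _ (by norm_num)) _ ?_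
    rw [SereginSverak2009.cylRadius_smul_eZ_add, hy₁r]
    linarith
  rw [hzero, zero_add] at hval
  have hcalc : M' * (1 - ε) = M / 2 + Cf := by
    rw [hε, hM']; field_simp; ring
  rw [hcalc] at hval
  linarith

/-- **A scalar vanishing far from the axis vanishes identically** (the case `L = 0` of
Lei–Ren–Zhang's Theorem 1.2; in print via Lei–Zhang–Zhao 2017, Remark 1.4 / Lemma 5.2): for a
bounded-drift swirl pair on `(−∞, τ)` with `|F| ≤ K r` and `F = 0` on `{r ≥ R₀}`, `F ≡ 0`
(apply `nonpos_of_vanish_far` to `F` and to `−F`). [cite: LeiRenZhang2019, proof of Thm 1.2, last lines (arXiv p. 12); LeiZhangZhao2017, Remark 1.4 and Lemma 5.2] -/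
theorem eq_zero_of_vanish_far
    (hF : ∀ t < τ, ContDiff ℝ ∞ (F t))
    (hFd : ContinuousOn (fun p : ℝ × (EuclideanSpace ℝ (Fin 3)) => fderiv ℝ (F p.1) p.2) (Iio τ ×ˢ univ))
    (hFΔ : ContinuousOn (fun p : ℝ × (EuclideanSpace ℝ (Fin 3)) => (Δ (F p.1)) p.2) (Iio τ ×ˢ univ))
    (hFa : ∀ t < τ, IsAxisymmetricScalar (F t))
    (hF0 : ∀ t < τ, ∀ x, cylRadius x = 0 → F t x = 0)
    (hFb : ∀ t < τ, ∀ x, |F t x| ≤ Cf)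
    (hVm : Measurable (uncurry V))
    (hVs : ∀ t < τ, ContDiff ℝ ∞ (V t))
    (hVdiv : ∀ t < τ, VectorCalculus.IsDivFree (V t))
    (hVb : ∀ t < τ, ∀ x, ‖V t x‖ ≤ Cu)
    (heq : ∀ x, cylRadius x ≠ 0 → ∀ s t : ℝ, s ≤ t → t < τ →
      F t x - F s x = ∫ r in s..t, ((Δ (F r)) x - fderiv ℝ (F r) x (V r x) -
        2 / cylRadius x * partialDeriv (eR x) (F r) x))
    {K R₀ : ℝ} (hK : ∀ t < τ, ∀ x, |F t x| ≤ K * cylRadius x)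
    (hfar : ∀ t < τ, ∀ x, R₀ ≤ cylRadius x → F t x = 0) :
    ∀ t < τ, ∀ x, F t x = 0 := by
  have hle : ∀ t < τ, ∀ x, F t x ≤ 0 :=
    nonpos_of_vanish_far hF hFd hFΔ hFa hF0 hFb hVm hVs hVdiv hVb heq hK hfar
  -- the hypotheses for `-F`
  have hneg : ∀ t, (fun x => -F t x) = -(F t) := fun t => rfl
  have h1' : ∀ t < τ, ContDiff ℝ ∞ fun x => -F t x := fun t ht => (hF t ht).neg
  have h2' : ContinuousOn (fun p : ℝ × (EuclideanSpace ℝ (Fin 3)) => fderiv ℝ (fun x => -F p.1 x) p.2)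
      (Iio τ ×ˢ univ) := by
    have : (fun p : ℝ × (EuclideanSpace ℝ (Fin 3)) => fderiv ℝ (fun x => -F p.1 x) p.2) =
        fun p => -fderiv ℝ (F p.1) p.2 := funext fun p => fderiv_fun_neg
    rw [this]
    exact hFd.neg
  have h3' : ContinuousOn (fun p : ℝ × (EuclideanSpace ℝ (Fin 3)) => (Δ fun x => -F p.1 x) p.2)
      (Iio τ ×ˢ univ) := by
    have : (fun p : ℝ × (EuclideanSpace ℝ (Fin 3)) => (Δ fun x => -F p.1 x) p.2) = fun p => -(Δ (F p.1)) p.2 :=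
      funext fun p => by rw [hneg, InnerProductSpace.laplacian_neg]; rfl
    rw [this]
    exact hFΔ.neg
  have h4' : ∀ t < τ, IsAxisymmetricScalar fun x => -F t x := fun t ht θ x => by
    simp only [hFa t ht θ x]
  have h5' : ∀ t < τ, ∀ x, cylRadius x = 0 → -F t x = 0 := fun t ht x hx => by
    rw [hF0 t ht x hx, neg_zero]
  have h6' : ∀ t < τ, ∀ x, |(-F t x)| ≤ Cf := fun t ht x => by rw [abs_neg]; exact hFb t ht x
  have hK' : ∀ t < τ, ∀ x, |(-F t x)| ≤ K * cylRadius x := fun t ht x => by rw [abs_neg]; exact hK t ht x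
  have hfar' : ∀ t < τ, ∀ x, R₀ ≤ cylRadius x → -F t x = 0 := fun t ht x hx => by
    rw [hfar t ht x hx, neg_zero]
  have h11' : ∀ x, cylRadius x ≠ 0 → ∀ s t : ℝ, s ≤ t → t < τ →
      (-F t x) - (-F s x) = ∫ r in s..t, ((Δ fun y => -F r y) x -
        fderiv ℝ (fun y => -F r y) x (V r x) -
        2 / cylRadius x * partialDeriv (eR x) (fun y => -F r y) x) := by
    intro x hx s t hst ht
    have hint : (fun r => (Δ fun y => -F r y) x - fderiv ℝ (fun y => -F r y) x (V r x) -
        2 / cylRadius x * partialDeriv (eR x) (fun y => -F r y) x) =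
        fun r => -((Δ (F r)) x - fderiv ℝ (F r) x (V r x) -
          2 / cylRadius x * partialDeriv (eR x) (F r) x) := by
      funext r
      rw [partialDeriv_apply, partialDeriv_apply, hneg, InnerProductSpace.laplacian_neg, fderiv_neg]
      simp only [Pi.neg_apply, neg_apply]
      ring
    rw [hint, intervalIntegral.integral_neg, ← heq x hx s t hst ht]
    ring
  have hge : ∀ t < τ, ∀ x, -F t x ≤ 0 :=
    nonpos_of_vanish_far h1' h2' h3' h4' h5' h6' hVm hVs hVdiv hVb h11' hK' hfar'
  intro t ht x
  have := hge t ht x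
  have := hle t ht x
  linarith

end Vanishing

/-! ### The sign of the scalar far from the axis -/

section Sign

/-- **The sign of an axisymmetric scalar far from the axis is constant in space and time**: if
`(F t)` are axisymmetric scalars, jointly continuous on `(−∞, τ) × ℝ³`, with `F(t, x)² ≥ c > 0`
whenever `r(x) ≥ R₁`, then either `F > 0` on `(−∞, τ) × {r ≥ R₁}` or `F < 0` there (`F(t, x)`
depends on `(t, r, z)` only, which ranges over a convex set where `F` does not vanish;
intermediate value theorem). [folklore] -/
theorem pos_or_neg_of_sq_ge (hFc : ContinuousOn (uncurry F) (Iio τ ×ˢ univ))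
    (hFa : ∀ t < τ, IsAxisymmetricScalar (F t)) {R₁ c : ℝ} (hc : 0 < c)
    (hsq : ∀ t < τ, ∀ x, R₁ ≤ cylRadius x → c ≤ F t x ^ 2) :
    (∀ t < τ, ∀ x, R₁ ≤ cylRadius x → 0 < F t x) ∨ (∀ t < τ, ∀ x, R₁ ≤ cylRadius x → F t x < 0) := by
  -- the profile on the convex parameter set `D = (−∞, τ) × [R₁, ∞) × ℝ`
  set g : ℝ × ℝ × ℝ → ℝ := fun q => F q.1 (meridianPoint (q.2.1, q.2.2)) with hg
  set D : Set (ℝ × ℝ × ℝ) := Iio τ ×ˢ (Ici R₁ ×ˢ univ) with hD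
  have hDconv : IsPreconnected D :=
    (convex_Iio τ).isPreconnected.prod ((convex_Ici R₁).isPreconnected.prod convex_univ.isPreconnected)
  have hgc : ContinuousOn g D := by
    have hmap : Continuous fun q : ℝ × ℝ × ℝ => ((q.1, meridianPoint (q.2.1, q.2.2)) : ℝ × EuclideanSpace ℝ (Fin 3)) :=
      continuous_fst.prodMk ((contDiff_meridianPoint (n := 0)).continuous.comp (continuous_fst.comp continuous_snd |>.prodMk
        (continuous_snd.comp continuous_snd)))
    have hmaps : MapsTo (fun q : ℝ × ℝ × ℝ => ((q.1, meridianPoint (q.2.1, q.2.2)) : ℝ × EuclideanSpace ℝ (Fin 3)))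
        D (Iio τ ×ˢ univ) := fun q hq => ⟨hq.1, mem_univ _⟩
    exact hFc.comp hmap.continuousOn hmaps
  -- `g ≠ 0` on `D`
  have hr : ∀ q ∈ D, R₁ ≤ cylRadius (meridianPoint (q.2.1, q.2.2)) := by
    intro q hq
    rw [cylRadius_meridianPoint_eq_abs]
    exact (show R₁ ≤ q.2.1 from hq.2.1).trans (le_abs_self _)
  have hg0 : ∀ q ∈ D, g q ≠ 0 := by
    intro q hq h0
    have := hsq q.1 hq.1 _ (hr q hq)
    rw [show F q.1 (meridianPoint (q.2.1, q.2.2)) = g q from rfl, h0] at this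
    norm_num at this
    linarith
  -- every value of `F` on `{r ≥ R₁}` is a value of `g` on `D`
  have hrep : ∀ t < τ, ∀ x, R₁ ≤ cylRadius x →
      ∃ q ∈ D, g q = F t x := by
    intro t ht x hx
    refine ⟨(t, cylRadius x, x 2), ⟨ht, hx, mem_univ _⟩, ?_⟩
    simp only [hg]
    exact ((hFa t ht).eq_comp_meridian x).symm
  -- if `g` took both signs it would vanish
  by_cases hp : ∃ q ∈ D, 0 < g q
  · left
    obtain ⟨q₀, hq₀, hq₀pos⟩ := hp
    intro t ht x hx
    obtain ⟨q, hq, hqx⟩ := hrep t ht x hx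
    rw [← hqx]
    by_contra hneg
    have hle : g q ≤ 0 := le_of_not_gt hneg
    have hmem : (0 : ℝ) ∈ Icc (g q) (g q₀) := ⟨hle, hq₀pos.le⟩
    obtain ⟨z, hz, hz0⟩ := hDconv.intermediate_value hq hq₀ hgc hmem
    exact hg0 z hz hz0
  · right
    push Not at hp
    intro t ht x hx
    obtain ⟨q, hq, hqx⟩ := hrep t ht x hx
    rw [← hqx]
    exact lt_of_le_of_ne (hp q hq) (hg0 q hq)

end Sign

end LRZPair

end Literature.Analysis.FluidPDE

end
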